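import Summits.Ventures.PercRepro.ExcessOneNoCrossingPair

/-!
# Theorem (W2′): the trace identity at a witness direction

Setting of `ExcessOneNoCrossingPair` (Addendum 24 and its supplement 1): `|F \\ F| = |F| + 1`,
`{r} ∈ F`, `proj r F` tight. A *witness* is a pair `x, insert b x` (`b ∉ x`) with `x ∈ F₀`,
`insert b x ∈ F₁` and not both in `K = F₀ ∩ F₁`. With `L₀`, `L₁`, `L = L₀ ∩ L₁` the lower ends of
the `b`-pairs of `F₀`, `F₁`, `K` and `Λ_b` the `b`-pairs of `Y`:

* `card_L_lt_card_lam_of_witness` (the sandwich exclusion): `|L| + 1 ≤ |Λ_b|`;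
* `tight_proj_of_witness`: **`proj b F` is tight**;
* `pair_mem_part0_or_partr_of_witness`: **every `b`-pair of the trace has both ends in `F₀` or
  both in `F₁`** (the general form of (W1), which is the case `e = x` of a witness with `x ∉ F₁`
  and `insert b x ∉ F₀`).
-/

namespace PercRepro.MSTight

open Finset
open scoped FinsetFamily

variable {α : Type*} [DecidableEq α] [Fintype α]

section WitnessDirection

variable {F : Finset (Finset α)} {r b : α}

/-- **The sandwich exclusion.** At a witness `x, insert b x` the `b`-pairs of `Y` outnumber the
`b`-pairs of the partner family: `|L| + 1 ≤ |Λ_b|` (no excess hypothesis is needed here: only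
`{r} ∈ F` and the tightness of the trace). -/
theorem card_L_lt_card_lam_of_witness (hP : Tight (proj r F)) (hr : ({r} : Finset α) ∈ F) {x : Finset α}
    (hx0 : x ∈ part0 r F) (hbx : b ∉ x) (hxb1 : insert b x ∈ partr r F)
    (hwit : ¬ (x ∈ partr r F ∧ insert b x ∈ part0 r F)) :
    (((part0 r F).filter fun s => b ∉ s ∧ insert b s ∈ part0 r F) ∩
        ((partr r F).filter fun t => b ∉ t ∧ insert b t ∈ partr r F)).card + 1 ≤
      ((diffsY r F).filter fun y => b ∉ y ∧ insert b y ∈ diffsY r F).card := by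
  have hbr : b ≠ r := by
    rintro rfl
    exact (mem_partr.1 hxb1).1 (mem_insert_self b x)
  set lam := (diffsY r F).filter fun y => b ∉ y ∧ insert b y ∈ diffsY r F with hlam
  set L0 := (part0 r F).filter fun s => b ∉ s ∧ insert b s ∈ part0 r F with hL0
  set L1 := (partr r F).filter fun t => b ∉ t ∧ insert b t ∈ partr r F with hL1
  set L := L0 ∩ L1 with hL
  by_contra hcon
  have hlamL : lam.card ≤ L.card := by omega
  -- `L \\ L ⊆ Λ`, so `L` is tight and `Λ = L \\ L`
  have hLL : L \\ L ⊆ lam := by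
    intro d hd
    obtain ⟨ℓ, hℓ, ℓ', hℓ', rfl⟩ := Finset.mem_diffs.1 hd
    rw [hL, mem_inter, hL0, hL1, mem_filter, mem_filter] at hℓ hℓ'
    rw [hlam, mem_filter]
    refine ⟨sdiff_mem_diffs hℓ.2.1 hℓ'.1.1, fun h => hℓ.1.2.1 (mem_sdiff.1 h).1, ?_⟩
    rw [← Finset.insert_sdiff_of_notMem ℓ hℓ'.1.2.1]
    exact sdiff_mem_diffs hℓ.2.2.2 hℓ'.1.1
  have hMS : L.card ≤ (L \\ L).card := Finset.card_le_card_diffs L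
  have hcardLL : (L \\ L).card = L.card := by
    have := card_le_card hLL; omega
  have hLt : Tight L := hcardLL
  have hlamEq : lam = L \\ L := by
    symm; apply eq_of_subset_of_card_le hLL; omega
  -- `∅ ∈ Λ`, hence `L` is nonempty
  have h0Y : (∅ : Finset α) ∈ partr r F := mem_partr.2 ⟨notMem_empty r, by simpa using hr⟩
  have hne : L.Nonempty := by
    have h0 : (∅ : Finset α) ∈ lam := by
      rw [hlam, mem_filter]
      refine ⟨?_, notMem_empty b, ?_⟩
      · have h := sdiff_mem_diffs h0Y hx0
        rw [Finset.empty_sdiff] at h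
        exact h
      · have : insert b x \ x = insert b (∅ : Finset α) := by
          rw [Finset.insert_sdiff_of_notMem x hbx, sdiff_self]; rfl
        rw [← this]; exact sdiff_mem_diffs hxb1 hx0
    rw [hlamEq] at h0
    exact Finset.Nonempty.of_diffs_left ⟨∅, h0⟩
  -- the differences of `x` with `L` lie in `L \\ L`, in both cases of the witness
  have hxL : ∀ ℓ ∈ L, x \ ℓ ∈ L \\ L := by
    intro ℓ hℓ
    rw [hL, mem_inter, hL0, hL1, mem_filter, mem_filter] at hℓ
    rw [← hlamEq, hlam, mem_filter]
    refine ⟨?_, fun h => hbx (mem_sdiff.1 h).1, ?_⟩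
    · rw [← insert_sdiff_insert_of_notMem hbx]
      exact sdiff_mem_diffs hxb1 hℓ.1.2.2
    · rw [← Finset.insert_sdiff_of_notMem x hℓ.1.2.1]
      exact sdiff_mem_diffs hxb1 hℓ.1.1
  have hLx : ∀ ℓ ∈ L, ℓ \ x ∈ L \\ L := by
    intro ℓ hℓ
    rw [hL, mem_inter, hL0, hL1, mem_filter, mem_filter] at hℓ
    rw [← hlamEq, hlam, mem_filter]
    refine ⟨sdiff_mem_diffs hℓ.2.1 hx0, fun h => hℓ.1.2.1 (mem_sdiff.1 h).1, ?_⟩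
    rw [← Finset.insert_sdiff_of_notMem ℓ hbx]
    exact sdiff_mem_diffs hℓ.2.2.2 hx0
  obtain ⟨ℓ₀, hℓ₀, hxℓ₀⟩ := subset_of_diffs_mem univ L x (fun E _ => subset_univ E)
    (subset_univ x) hne hLt hxL
  obtain ⟨ℓ₁, hℓ₁, hℓ₁x⟩ := exists_subset_of_sdiff_mem univ L x (fun E _ => subset_univ E)
    (subset_univ x) hne hLt hLx
  have hTC : TwinClosed L x := by
    have hx_eq : ℓ₁ ∪ x \ ℓ₁ = x := union_sdiff_of_subset hℓ₁x
    rw [← hx_eq]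
    exact (twinClosed_of_mem hℓ₁).union (twinClosed_of_mem_diffs (hxL ℓ₁ hℓ₁))
  have hxmem : x ∈ L := mem_of_subset_of_subset_of_twinClosed_of_tight hLt hℓ₁ hℓ₀ hℓ₁x hxℓ₀ hTC
  -- `x ∈ L ⊆ L₀ ∩ L₁`: both `x` and `insert b x` lie in `K`, against the witness
  have hx1 : x ∈ partr r F := (mem_filter.1 (mem_inter.1 hxmem).2).1
  have hxb0 : insert b x ∈ part0 r F := (mem_filter.1 (mem_inter.1 hxmem).1).2.2
  exact hwit ⟨hx1, hxb0⟩

/-- **(W2′ b).** At a witness direction `b` the projection `proj b F` is tight. -/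
theorem tight_proj_of_witness (hF : (F \\ F).card = F.card + 1)
    (hP : Tight (proj r F)) (hr : ({r} : Finset α) ∈ F) {x : Finset α}
    (hx0 : x ∈ part0 r F) (hbx : b ∉ x) (hxb1 : insert b x ∈ partr r F)
    (hwit : ¬ (x ∈ partr r F ∧ insert b x ∈ part0 r F)) : Tight (proj b F) := by
  have hbr : b ≠ r := by
    rintro rfl
    exact (mem_partr.1 hxb1).1 (mem_insert_self b x)
  have hX : diffsX r F = proj r F := diffsX_eq_proj_of_singleton_mem hP hr
  set lk := (proj r F).filter fun e => b ∉ e ∧ insert b e ∈ proj r F with hlk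
  set lam := (diffsY r F).filter fun y => b ∉ y ∧ insert b y ∈ diffsY r F with hlam
  set L0 := (part0 r F).filter fun s => b ∉ s ∧ insert b s ∈ part0 r F with hL0
  set L1 := (partr r F).filter fun t => b ∉ t ∧ insert b t ∈ partr r F with hL1
  have hS : (L0 ∩ L1).card + 1 ≤ lam.card :=
    card_L_lt_card_lam_of_witness hP hr hx0 hbx hxb1 hwit
  have hA : lk.card + lam.card ≤ (diffsX b F ∩ diffsY b F).card := card_lk_add_card_lam_le hbr hX
  have hC : (partner b F).card ≤ L0.card + L1.card := card_partner_le_card_L0_add_card_L1 hbr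
  have hD : (L0 ∪ L1).card ≤ lk.card := by
    apply card_le_card
    apply union_subset
    · intro s hs
      rw [hL0, mem_filter] at hs
      rw [hlk, mem_filter, proj_eq_union]
      exact ⟨mem_union_left _ hs.1, hs.2.1, mem_union_left _ hs.2.2⟩
    · intro t ht
      rw [hL1, mem_filter] at ht
      rw [hlk, mem_filter, proj_eq_union]
      exact ⟨mem_union_right _ ht.1, ht.2.1, mem_union_right _ ht.2.2⟩
  have hE : (L0 ∪ L1).card + (L0 ∩ L1).card = L0.card + L1.card := card_union_add_card_inter L0 L1
  have h1 := card_diffs_eq_card_diffs_proj_add b F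
  have h2 := card_eq_card_proj_add_card_partner b F
  have h3 := Finset.card_le_card_diffs (proj b F)
  unfold Tight
  omega

/-- **(W2′ a).** At a witness direction `b`, every `b`-pair `e, insert b e` of the trace has both
ends in `F₀` or both ends in `F₁`. -/
theorem pair_mem_part0_or_partr_of_witness (hF : (F \\ F).card = F.card + 1)
    (hP : Tight (proj r F)) (hr : ({r} : Finset α) ∈ F) {x : Finset α}
    (hx0 : x ∈ part0 r F) (hbx : b ∉ x) (hxb1 : insert b x ∈ partr r F)
    (hwit : ¬ (x ∈ partr r F ∧ insert b x ∈ part0 r F)) {e : Finset α} (he : e ∈ proj r F)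
    (hbe : b ∉ e) (heb : insert b e ∈ proj r F) :
    (e ∈ part0 r F ∧ insert b e ∈ part0 r F) ∨ (e ∈ partr r F ∧ insert b e ∈ partr r F) := by
  by_contra hcon
  have hbr : b ≠ r := by
    rintro rfl
    exact (mem_partr.1 hxb1).1 (mem_insert_self b x)
  have hX : diffsX r F = proj r F := diffsX_eq_proj_of_singleton_mem hP hr
  set lk := (proj r F).filter fun e => b ∉ e ∧ insert b e ∈ proj r F with hlk
  set lam := (diffsY r F).filter fun y => b ∉ y ∧ insert b y ∈ diffsY r F with hlam
  set L0 := (part0 r F).filter fun s => b ∉ s ∧ insert b s ∈ part0 r F with hL0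
  set L1 := (partr r F).filter fun t => b ∉ t ∧ insert b t ∈ partr r F with hL1
  have hS : (L0 ∩ L1).card + 1 ≤ lam.card :=
    card_L_lt_card_lam_of_witness hP hr hx0 hbx hxb1 hwit
  have hA : lk.card + lam.card ≤ (diffsX b F ∩ diffsY b F).card := card_lk_add_card_lam_le hbr hX
  have hB : (diffsX b F ∩ diffsY b F).card ≤ (partner b F).card + 1 :=
    card_diffsX_inter_diffsY_le_of_card_diffs_eq b hF
  have hC : (partner b F).card ≤ L0.card + L1.card := card_partner_le_card_L0_add_card_L1 hbr
  have hD : (L0 ∪ L1).card + 1 ≤ lk.card := by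
    have he_lk : e ∈ lk := by
      rw [hlk, mem_filter]; exact ⟨he, hbe, heb⟩
    have he_not : e ∉ L0 ∪ L1 := by
      rw [mem_union, hL0, hL1, mem_filter, mem_filter]
      rintro (⟨h1, _, h2⟩ | ⟨h1, _, h2⟩)
      · exact hcon (Or.inl ⟨h1, h2⟩)
      · exact hcon (Or.inr ⟨h1, h2⟩)
    have hsub : insert e (L0 ∪ L1) ⊆ lk := by
      apply insert_subset he_lk
      apply union_subset
      · intro s hs
        rw [hL0, mem_filter] at hs
        rw [hlk, mem_filter, proj_eq_union]
        exact ⟨mem_union_left _ hs.1, hs.2.1, mem_union_left _ hs.2.2⟩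
      · intro t ht
        rw [hL1, mem_filter] at ht
        rw [hlk, mem_filter, proj_eq_union]
        exact ⟨mem_union_right _ ht.1, ht.2.1, mem_union_right _ ht.2.2⟩
    calc (L0 ∪ L1).card + 1 = (insert e (L0 ∪ L1)).card := (card_insert_of_notMem he_not).symm
      _ ≤ lk.card := card_le_card hsub
  have hE : (L0 ∪ L1).card + (L0 ∩ L1).card = L0.card + L1.card := card_union_add_card_inter L0 L1
  omega

/-- A difference of two members of the trace lies in the trace (convexity of the tight trace
between `∅` and a member; `{r} ∈ F` puts `∅` in the trace). -/
theorem sdiff_mem_proj_of_tight (hP : Tight (proj r F)) (hr : ({r} : Finset α) ∈ F)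
    {p q : Finset α} (hp : p ∈ proj r F) (hq : q ∈ proj r F) : p \ q ∈ proj r F := by
  have h0 : (∅ : Finset α) ∈ proj r F := by
    rw [proj_eq_union]
    exact mem_union_right _ (mem_partr.2 ⟨notMem_empty r, by simpa using hr⟩)
  exact mem_of_subset_of_subset_of_twinClosed_of_tight hP h0 hp (empty_subset _) sdiff_subset
    (twinClosed_of_mem_diffs (sdiff_mem_diffs hp hq))

/-- **(Addendum 24, supplement 3.)** At a `(P₀, K)` witness `x, insert b x` (so `x ∉ F₁`), a
member `s ∈ F₀` with `x \ s ∉ Y` («`s` does not complete `x`») has `b ∉ s`, and the difference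
`x \ s` is itself a member avoiding `r` without its `r`-partner whose `b`-extension is a member:
`x \ s ∈ F₀ \ F₁` and `insert b (x \ s) ∈ F₀`. -/
theorem sdiff_mem_part0_of_not_mem_diffsY (hF : (F \\ F).card = F.card + 1)
    (hP : Tight (proj r F)) (hr : ({r} : Finset α) ∈ F) {x : Finset α}
    (hx0 : x ∈ part0 r F) (hx1 : x ∉ partr r F) (hbx : b ∉ x) (hxb1 : insert b x ∈ partr r F)
    {s : Finset α} (hs : s ∈ part0 r F) (hys : x \ s ∉ diffsY r F) :
    b ∉ s ∧ x \ s ∈ part0 r F ∧ x \ s ∉ partr r F ∧ insert b (x \ s) ∈ part0 r F := by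
  have hwit : ¬ (x ∈ partr r F ∧ insert b x ∈ part0 r F) := fun h => hx1 h.1
  have hbs : b ∉ s := by
    intro hbs
    apply hys
    have h := sdiff_mem_diffs hxb1 hs
    rwa [Finset.insert_sdiff_of_mem x hbs] at h
  -- the two faces `x \ s` and `insert b (x \ s) = insert b x \ s`
  have hxP : x ∈ proj r F := by rw [proj_eq_union]; exact mem_union_left _ hx0
  have hsP : s ∈ proj r F := by rw [proj_eq_union]; exact mem_union_left _ hs
  have hxbP : insert b x ∈ proj r F := by rw [proj_eq_union]; exact mem_union_right _ hxb1
  have he : x \ s ∈ proj r F := sdiff_mem_proj_of_tight hP hr hxP hsP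
  have hbe : b ∉ x \ s := fun h => hbx (mem_sdiff.1 h).1
  have heb : insert b (x \ s) ∈ proj r F := by
    rw [← Finset.insert_sdiff_of_notMem x hbs]
    exact sdiff_mem_proj_of_tight hP hr hxbP hsP
  -- `x \ s ∉ F₁`: otherwise `x \ s = (x \ s) \ s` would be a type-I difference
  have hnot1 : x \ s ∉ partr r F := by
    intro h1
    apply hys
    have h := sdiff_mem_diffs h1 hs
    have hss : (x \ s) \ s = x \ s := by
      ext a; simp only [mem_sdiff]; tauto
    rwa [hss] at h
  rcases pair_mem_part0_or_partr_of_witness hF hP hr hx0 hbx hxb1 hwit he hbe heb with h | h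
  · exact ⟨hbs, h.1, hnot1, h.2⟩
  · exact absurd h.1 hnot1

end WitnessDirection

end PercRepro.MSTight
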